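import Literature.Geometry.Kaehler.ComplexTorusIntegralHodgeLatticeLefschetzPiecesRank
import HarnessLib

/-!
# Discriminant of the integral Lefschetz decomposition: `disc(⊕_s Lˢ Hdg^{p−s}(X, ℤ)_prim) = ∏_s disc(Lˢ Hdg^{p−s}(X, ℤ)_prim)`
# `= [Hdgᵖ(X, ℤ) : ⊕_s N_s]² · disc Hdgᵖ(X, ℤ)`

Layer `Literature/Geometry/Kaehler`, namespace `Literature.Geometry.Kaehler.ComplexTorus`; lane `lit-hodgefound`
(Track 2 foundations library), seat p09, generation 47, row g47-#5. THEOREMS ONLY (0 definitions); no named fact, net debt 0.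
The Gram-determinant bookkeeping of g47-#3's orthogonal direct sum `⊕_s N_s ⊆ Hdgᵖ(X, ℤ)`, `N_s = Lˢ Hdg^{p−s}(X, ℤ)_prim`, of Lefschetz pieces
of the integral Hodge lattice of a polarised abelian variety (`B_k` the integral Lefschetz form `⟨·, γ_q ∧ ·⟩` on `Hᵏ(X, ℤ)`, `k + q = g`):

* §0 (private) `det (blockDiagonal' d) = ∏_k det d_k` for square blocks of different sizes.
* §1 LATTICE GENERALITIES (any commutative ring): the Gram matrix of a bilinear form in the collected basis of an internal direct sum with
  pairwise `B`-orthogonal summands is BLOCK DIAGONAL (`toMatrix_collectedBasis_eq_blockDiagonal'_of_forall_apply_eq_zero`), so its determinant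
  is the product of the summands' Gram determinants (`det_toMatrix_collectedBasis_eq_prod_of_forall_apply_eq_zero`); for an INDEPENDENT pairwise
  orthogonal family `N` of submodules, `⨆_s N_s` has a basis assembled from bases of the `N_s` in which **`disc(⨆_s N_s) = ∏_s disc(N_s)`**
  (`exists_basis_iSup_det_toMatrix_restrict_eq_prod`) — Kitaoka's "`d(L₁ ⊥ L₂) = dL₁ · dL₂`".
* §2 THE LEFSCHETZ PIECES: **`disc(⊕_s N_s) = ∏_s disc(N_s)`, every `disc(N_s) ≠ 0`, `disc(⊕_s N_s) ≠ 0`**, `B_k` non-degenerate on `⊕_s N_s`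
  (`IsPolarizationType.exists_basis_iSup_lefschetzPieces_det_eq_prod`, `….nondegenerate_restrict_iSup_lefschetzPieces`).
* §3 **`∏_s disc(N_s) = [Hdgᵖ(X, ℤ) : ⊕_s N_s]² · disc Hdgᵖ(X, ℤ)`** (`IsPolarizationType.prod_det_lefschetzPieces_eq_index_sq_mul_det`): Huybrechts'
  (0.1) `disc Λ₁ = (Λ : Λ₁)² · disc Λ` for the full-rank sublattice `⊕_s N_s` of `Λ = Hdgᵖ(X, ℤ)` (pulled back along `Hdgᵖ(X, ℤ) ↪ Hᵏ(X, ℤ)`,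
  in any `ℤ`-basis of `Hdgᵖ(X, ℤ)` indexed like the collected basis — such bases exist by g47-#4's rank count,
  `….exists_basis_integralHodgeClassesIn_sigma`), whence **`disc Hdgᵖ(X, ℤ) ≠ 0` divides `∏_s disc(N_s)`** with quotient the
  squared index (`….det_integralHodgeClassesIn_dvd_prod_det_lefschetzPieces`).

## References

* [cite: Huybrechts2016K3, Ch. 14 §0.1 (0.1), (0.2), §0.2]
* [cite: Kitaoka1993, Ch. 5 §5.3 Prop. 5.3.3 (proof) and §1.2 ("`d(L₁ ⊥ L₂) = dL₁ dL₂`")]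
* [cite: Lange2023AbelianVarietiesComplex, §5.4.1 Thm. 5.4.2 and (5.22)–(5.23) (PDF p. 275); §7.3.2 (3)]
* [cite: VoisinHodgeI2002, §6.3.2 Lemma 6.31, Thm. 6.32 (PDF p. 128)]
-/

noncomputable section

-- `Module ℂ` / `SMulZeroClass ℂ` synthesis on `E [⋀^Fin k]→L[ℝ] ℂ` (as in `ComplexTorusLefschetzDecomposition`)
set_option maxSynthPendingDepth 3

open Module Function Complex
open LinearMap (BilinForm)
open Literature.LinearAlgebra.Alternating
open Literature.Analysis.Complex (IsOfTypeAt typeSubmodule)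

namespace Literature.Geometry.Kaehler.ComplexTorus

/-! ## §0 `det (blockDiagonal' d) = ∏_k det d_k` -/

/-- `det (blockDiagonal' d) = ∏ₖ det dₖ` for square blocks of different sizes (Mathlib's `Matrix.det_blockDiagonal` is the equal-size case; via
block-triangularity along an enumeration of the block index). [folklore] -/
private theorem det_blockDiagonal'_eq_prod₈₅ {K : Type*} [CommRing K] {κ : Type*} [Fintype κ] [DecidableEq κ]
    {σ : κ → Type*} [∀ k, Fintype (σ k)] [∀ k, DecidableEq (σ k)] (d : ∀ k, Matrix (σ k) (σ k) K) :
    (Matrix.blockDiagonal' d).det = ∏ k, (d k).det := by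
  let e := Fintype.equivFin κ
  have hT : (Matrix.blockDiagonal' d).BlockTriangular (fun a : Σ j, σ j ↦ e a.1) := by
    rintro ⟨i, x⟩ ⟨j, y⟩ h
    exact Matrix.blockDiagonal'_apply_ne d x y fun hij ↦ absurd (congrArg (⇑e) hij.symm) (ne_of_lt h)
  rw [hT.det_fintype]
  refine (Fintype.prod_equiv e (fun k ↦ (d k).det) _ fun k ↦ ?_).symm
  let f₀ : σ k ≃ {a : Σ j, σ j // a.1 = k} :=
    { toFun := fun x ↦ ⟨⟨k, x⟩, rfl⟩
      invFun := fun a ↦ a.2 ▸ a.1.2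
      left_inv := fun _ ↦ rfl
      right_inv := by
        rintro ⟨⟨j, x⟩, h⟩
        subst h
        rfl }
  let f : σ k ≃ {a : Σ j, σ j // e a.1 = e k} :=
    f₀.trans (Equiv.subtypeEquivRight fun a ↦ e.injective.eq_iff.symm)
  rw [Matrix.toSquareBlock_def, ← Matrix.det_submatrix_equiv_self f]
  congr 1
  ext x y
  simp only [Matrix.submatrix_apply]
  exact (Matrix.blockDiagonal'_apply_eq d k x y).symm

/-! ## §1 Lattice generalities: the Gram matrix of an orthogonal direct sum is block diagonal, `disc(⨆_s N_s) = ∏_s disc(N_s)` -/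

section Generic

variable {R M : Type*} [CommRing R] [AddCommGroup M] [Module R M]

/-- **The Gram matrix of an orthogonal internal direct sum is block diagonal**: for an internal direct sum `M = ⊕_s A_s` with pairwise
`B`-orthogonal summands and bases `v_s` of the `A_s`, the Gram matrix of `B` in the collected basis is `blockDiagonal'` of the Gram matrices of
the restrictions `B∣A_s`. [cite: Kitaoka1993, Ch. 5 §5.3 Prop. 5.3.3 (proof) and §1.2] [cite: Huybrechts2016K3, Ch. 14 §0.1] -/
theorem toMatrix_collectedBasis_eq_blockDiagonal'_of_forall_apply_eq_zero (B : BilinForm R M) {σ : Type*} [Fintype σ] [DecidableEq σ]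
    {A : σ → Submodule R M} (h : DirectSum.IsInternal A) {κ : σ → Type*} [∀ s, Fintype (κ s)] [∀ s, DecidableEq (κ s)]
    (v : ∀ s, Basis (κ s) R ↥(A s)) (hO : ∀ s t, s ≠ t → ∀ x ∈ A s, ∀ y ∈ A t, B x y = 0) :
    LinearMap.BilinForm.toMatrix (h.collectedBasis v) B = Matrix.blockDiagonal' fun s ↦ LinearMap.BilinForm.toMatrix (v s) (B.restrict (A s)) := by
  ext ⟨s, a⟩ ⟨t, c⟩
  rw [LinearMap.BilinForm.toMatrix_apply, h.collectedBasis_coe, Matrix.blockDiagonal'_apply]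
  split_ifs with hst
  · cases hst
    rw [LinearMap.BilinForm.toMatrix_apply, LinearMap.BilinForm.restrict_apply]
    rfl
  · exact hO s t hst _ (v s a).2 _ (v t c).2

/-- **`disc(⊕_s A_s) = ∏_s disc(A_s)`** in the collected basis of an orthogonal internal direct sum.
[cite: Kitaoka1993, Ch. 5 §1.2 ("`d(L₁ ⊥ L₂) = dL₁ · dL₂`") and §5.3] [cite: Huybrechts2016K3, Ch. 14 §0.1] -/
theorem det_toMatrix_collectedBasis_eq_prod_of_forall_apply_eq_zero (B : BilinForm R M) {σ : Type*} [Fintype σ] [DecidableEq σ]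
    {A : σ → Submodule R M} (h : DirectSum.IsInternal A) {κ : σ → Type*} [∀ s, Fintype (κ s)] [∀ s, DecidableEq (κ s)]
    (v : ∀ s, Basis (κ s) R ↥(A s)) (hO : ∀ s t, s ≠ t → ∀ x ∈ A s, ∀ y ∈ A t, B x y = 0) :
    (LinearMap.BilinForm.toMatrix (h.collectedBasis v) B).det = ∏ s, (LinearMap.BilinForm.toMatrix (v s) (B.restrict (A s))).det := by
  rw [toMatrix_collectedBasis_eq_blockDiagonal'_of_forall_apply_eq_zero B h v hO, det_blockDiagonal'_eq_prod₈₅]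

/-- The traces `N_s ∩ (⨆ N)` of an independent family in its span form an independent family of submodules of `↥(⨆_s N_s)`. [folklore] -/
private theorem iSupIndep_comap_subtype_iSup {σ : Type*} {N : σ → Submodule R M} (hind : iSupIndep N) :
    iSupIndep fun s ↦ (N s).comap (⨆ s, N s).subtype := by
  rw [iSupIndep_def]
  intro s
  rw [Submodule.disjoint_def]
  intro x hx hx'
  have h1 : ((x : ↥(⨆ s, N s)) : M) ∈ N s := hx
  have h2 : ((x : ↥(⨆ s, N s)) : M) ∈ ⨆ (t) (_ : t ≠ s), N t := by
    have h := Submodule.mem_map_of_mem (f := (⨆ s, N s).subtype) hx'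
    rw [Submodule.map_iSup] at h
    simp_rw [Submodule.map_iSup] at h
    exact iSup₂_mono (fun t _ ↦ Submodule.map_comap_le _ _) h
  exact Subtype.ext ((Submodule.disjoint_def.1 (iSupIndep_def.1 hind s)) _ h1 h2)

/-- The traces `N_s ∩ (⨆ N)` span `↥(⨆_s N_s)`. [folklore] -/
private theorem iSup_comap_subtype_iSup_eq_top {σ : Type*} (N : σ → Submodule R M) :
    (⨆ s, (N s).comap (⨆ s, N s).subtype) = ⊤ := by
  apply Submodule.map_injective_of_injective (⨆ s, N s).injective_subtype
  rw [Submodule.map_iSup, Submodule.map_subtype_top]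
  simp_rw [Submodule.map_comap_subtype]
  exact le_antisymm (iSup_mono fun s ↦ inf_le_right) (iSup_mono fun s ↦ le_inf (le_iSup N s) le_rfl)

/-- **`disc(⨆_s N_s) = ∏_s disc(N_s)` for an independent, pairwise `B`-orthogonal family of submodules**: `⨆_s N_s` has a basis assembled from
given bases `b_s` of the `N_s` (its `⟨s, a⟩`-th vector is `b_s a`) in which the Gram determinant of `B∣⨆ N_s` is the product of the Gram determinants
of the `B∣N_s` — "`d(L₁ ⊥ ⋯ ⊥ L_r) = dL₁ ⋯ dL_r`". [cite: Kitaoka1993, Ch. 5 §1.2 and §5.3 Prop. 5.3.3 (proof)] [cite: Huybrechts2016K3, Ch. 14 §0.1, §0.2] -/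
theorem exists_basis_iSup_det_toMatrix_restrict_eq_prod (B : BilinForm R M) {σ : Type*} [Fintype σ] [DecidableEq σ]
    (N : σ → Submodule R M) (hind : iSupIndep N) (hO : ∀ s t, s ≠ t → ∀ x ∈ N s, ∀ y ∈ N t, B x y = 0)
    {κ : σ → Type*} [∀ s, Fintype (κ s)] [∀ s, DecidableEq (κ s)] (b : ∀ s, Basis (κ s) R ↥(N s)) :
    ∃ c : Basis (Σ s, κ s) R ↥(⨆ s, N s),
      (∀ s a, ((c ⟨s, a⟩ : ↥(⨆ s, N s)) : M) = b s a) ∧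
      (LinearMap.BilinForm.toMatrix c (B.restrict (⨆ s, N s))).det = ∏ s, (LinearMap.BilinForm.toMatrix (b s) (B.restrict (N s))).det := by
  have hInt := DirectSum.isInternal_submodule_of_iSupIndep_of_iSup_eq_top (iSupIndep_comap_subtype_iSup hind)
    (iSup_comap_subtype_iSup_eq_top N)
  let v : ∀ s, Basis (κ s) R ↥((N s).comap (⨆ s, N s).subtype) := fun s ↦
    (b s).map (Submodule.comapSubtypeEquivOfLe (le_iSup N s)).symm
  have hv : ∀ s a, (((v s a : ↥((N s).comap (⨆ s, N s).subtype)) : ↥(⨆ s, N s)) : M) = b s a := fun s a ↦ by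
    simp only [v, Basis.map_apply, Submodule.comapSubtypeEquivOfLe_symm_apply]
  have hO' : ∀ s t, s ≠ t → ∀ x ∈ (N s).comap (⨆ s, N s).subtype, ∀ y ∈ (N t).comap (⨆ s, N s).subtype,
      B.restrict (⨆ s, N s) x y = 0 := fun s t hst x hx y hy ↦ hO s t hst _ hx _ hy
  refine ⟨hInt.collectedBasis v,
    fun s a ↦ (congrArg (fun w : ↥(⨆ s, N s) ↦ (w : M)) (congrFun (hInt.collectedBasis_coe v) ⟨s, a⟩)).trans (hv s a), ?_⟩
  · rw [det_toMatrix_collectedBasis_eq_prod_of_forall_apply_eq_zero (B.restrict (⨆ s, N s)) hInt v hO']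
    refine Finset.prod_congr rfl fun s _ ↦ congrArg Matrix.det (Matrix.ext fun a a' ↦ ?_)
    simp only [LinearMap.BilinForm.toMatrix_apply, LinearMap.BilinForm.restrict_apply, LinearMap.domRestrict_apply, hv]

end Generic

/-! ## §2 The Lefschetz pieces: `disc(⊕_s N_s) = ∏_s disc(N_s) ≠ 0` -/

section Pieces

variable {ι : Type*} [Fintype ι] [DecidableEq ι] {E : Type*} [NormedAddCommGroup E] [NormedSpace ℂ E]
  {Φ : (ι → ℝ) ≃L[ℝ] E} {j n k q p : ℕ} {η : E [⋀^Fin 2]→L[ℝ] ℝ} {d : Fin (j + 2) → ℕ}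

/-- **`disc(⊕_s Lˢ Hdg^{p−s}(X, ℤ)_prim) = ∏_s disc(Lˢ Hdg^{p−s}(X, ℤ)_prim)`, each factor `≠ 0`**: for the family `N` of Lefschetz pieces of
`Hᵏ(X, ℤ)` (membership predicate `hN`) and any `ℤ`-bases `b_s` of the pieces, `⨆_s N_s` has the assembled basis `c` (`c ⟨s, a⟩ = b_s a`) in which the
Gram determinant of `B_k` is the product of the pieces' Gram determinants (g47-#3: the pieces are independent and pairwise `B_k`-orthogonal), and every
factor is non-zero (`B_k∣N_s` is non-degenerate — anisotropic by Hodge–Riemann).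
[cite: VoisinHodgeI2002, §6.3.2 Lemma 6.31, Thm. 6.32 (PDF p. 128)] [cite: Kitaoka1993, Ch. 5 §1.2, §5.3 Prop. 5.3.3 (proof)] [cite: Huybrechts2016K3, Ch. 14 §0.1, §0.2]
[cite: Lange2023AbelianVarietiesComplex, §5.4.1 Thm. 5.4.2 and (5.22)–(5.23) (PDF p. 275)] -/
theorem IsPolarizationType.exists_basis_iSup_lefschetzPieces_det_eq_prod (hd : IsPolarizationType Φ η d) (hη : IsRiemannForm Φ η)
    (hkq : k + q = j + 2) (hq : q ≤ j + 2) {γ : E [⋀^Fin (2 * q)]→L[ℝ] ℂ}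
    (hγ : wedgePow (ofRealForm η) q = ((q.factorial * ∏ i : Fin q, d (Fin.castLE hq i) : ℕ) : ℂ) • γ)
    (e : Fin n ≃ ι) (hn : k + (2 * q + k) = n) {B : BilinForm ℤ ↥(integralForms Φ k)}
    (hB : ∀ x y : ↥(integralForms Φ k),
      ((B x y : ℤ) : ℂ) = poincarePairing Φ e hn (x : E [⋀^Fin k]→L[ℝ] ℂ) (γ.wedge (y : E [⋀^Fin k]→L[ℝ] ℂ)))
    (N : Fin (p + 1) → Submodule ℤ ↥(integralForms Φ k))
    (hN : ∀ (s : Fin (p + 1)) (u : ↥(integralForms Φ k)), u ∈ N s ↔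
      ∃ (m i : ℕ) (_ : i + i = m) (h : 2 * (s : ℕ) + m = k) (y : E [⋀^Fin m]→L[ℝ] ℂ),
        y ∈ integralHodgeClassesIn Φ m i ∧ y ∈ primitiveForms η m ∧ (u : E [⋀^Fin k]→L[ℝ] ℂ) = lefschetzPow η (s : ℕ) h y)
    {κ : Fin (p + 1) → Type*} [∀ s, Fintype (κ s)] [∀ s, DecidableEq (κ s)] (b : ∀ s, Basis (κ s) ℤ ↥(N s)) :
    ∃ c : Basis (Σ s, κ s) ℤ ↥(⨆ s, N s),
      (∀ s a, ((c ⟨s, a⟩ : ↥(⨆ s, N s)) : ↥(integralForms Φ k)) = b s a) ∧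
      (LinearMap.BilinForm.toMatrix c (B.restrict (⨆ s, N s))).det = ∏ s, (LinearMap.BilinForm.toMatrix (b s) (B.restrict (N s))).det ∧
      ∀ s, (LinearMap.BilinForm.toMatrix (b s) (B.restrict (N s))).det ≠ 0 := by
  obtain ⟨hind, hO, -⟩ := hd.iSupIndep_lefschetzPieces hη hkq hq hγ e hn hB N hN
  obtain ⟨c, hc, hdet⟩ := exists_basis_iSup_det_toMatrix_restrict_eq_prod B N hind hO b
  exact ⟨c, hc, hdet, fun s ↦ (LinearMap.BilinForm.nondegenerate_iff_det_ne_zero (b s)).1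
    (hd.nondegenerate_restrict_lefschetzPiece hη hkq hq hγ e hn hB (hN s))⟩

/-- **`disc(⊕_s Lˢ Hdg^{p−s}(X, ℤ)_prim) ≠ 0`** in the assembled basis, and **`B_k` is non-degenerate on `⊕_s N_s`**.
[cite: VoisinHodgeI2002, §6.3.2 Thm. 6.32 (PDF p. 128)] [cite: Huybrechts2016K3, Ch. 14 §0.1] -/
theorem IsPolarizationType.nondegenerate_restrict_iSup_lefschetzPieces (hd : IsPolarizationType Φ η d) (hη : IsRiemannForm Φ η)
    (hkq : k + q = j + 2) (hq : q ≤ j + 2) {γ : E [⋀^Fin (2 * q)]→L[ℝ] ℂ}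
    (hγ : wedgePow (ofRealForm η) q = ((q.factorial * ∏ i : Fin q, d (Fin.castLE hq i) : ℕ) : ℂ) • γ)
    (e : Fin n ≃ ι) (hn : k + (2 * q + k) = n) {B : BilinForm ℤ ↥(integralForms Φ k)}
    (hB : ∀ x y : ↥(integralForms Φ k),
      ((B x y : ℤ) : ℂ) = poincarePairing Φ e hn (x : E [⋀^Fin k]→L[ℝ] ℂ) (γ.wedge (y : E [⋀^Fin k]→L[ℝ] ℂ)))
    (N : Fin (p + 1) → Submodule ℤ ↥(integralForms Φ k))
    (hN : ∀ (s : Fin (p + 1)) (u : ↥(integralForms Φ k)), u ∈ N s ↔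
      ∃ (m i : ℕ) (_ : i + i = m) (h : 2 * (s : ℕ) + m = k) (y : E [⋀^Fin m]→L[ℝ] ℂ),
        y ∈ integralHodgeClassesIn Φ m i ∧ y ∈ primitiveForms η m ∧ (u : E [⋀^Fin k]→L[ℝ] ℂ) = lefschetzPow η (s : ℕ) h y)
    {κ : Fin (p + 1) → Type*} [∀ s, Fintype (κ s)] [∀ s, DecidableEq (κ s)] (b : ∀ s, Basis (κ s) ℤ ↥(N s)) :
    (∃ c : Basis (Σ s, κ s) ℤ ↥(⨆ s, N s),
      (∀ s a, ((c ⟨s, a⟩ : ↥(⨆ s, N s)) : ↥(integralForms Φ k)) = b s a) ∧ (LinearMap.BilinForm.toMatrix c (B.restrict (⨆ s, N s))).det ≠ 0) ∧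
      (B.restrict (⨆ s, N s)).Nondegenerate := by
  obtain ⟨c, hc, hdet, hne⟩ := hd.exists_basis_iSup_lefschetzPieces_det_eq_prod hη hkq hq hγ e hn hB N hN b
  have hne' : (LinearMap.BilinForm.toMatrix c (B.restrict (⨆ s, N s))).det ≠ 0 := by
    rw [hdet]
    exact Finset.prod_ne_zero_iff.2 fun s _ ↦ hne s
  exact ⟨⟨c, hc, hne'⟩, (LinearMap.BilinForm.nondegenerate_iff_det_ne_zero c).2 hne'⟩

/-! ## §3 `∏_s disc(N_s) = [Hdgᵖ(X, ℤ) : ⊕_s N_s]² · disc Hdgᵖ(X, ℤ)` -/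

omit [Fintype ι] [DecidableEq ι] in
/-- The sum of the Lefschetz pieces lies in the range of the inclusion `Hdgᵖ(X, ℤ) ↪ Hᵏ(X, ℤ)` (`k = p + p`). [cite: VoisinHodgeI2002, §6.2.3 Rem. 6.27 (PDF p. 126)] -/
theorem iSup_lefschetzPieces_le_range_inclusion (hη : IsRiemannForm Φ η) (hpk : p + p = k)
    (N : Fin (p + 1) → Submodule ℤ ↥(integralForms Φ k))
    (hN : ∀ (s : Fin (p + 1)) (u : ↥(integralForms Φ k)), u ∈ N s ↔
      ∃ (m i : ℕ) (_ : i + i = m) (h : 2 * (s : ℕ) + m = k) (y : E [⋀^Fin m]→L[ℝ] ℂ),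
        y ∈ integralHodgeClassesIn Φ m i ∧ y ∈ primitiveForms η m ∧ (u : E [⋀^Fin k]→L[ℝ] ℂ) = lefschetzPow η (s : ℕ) h y) :
    (⨆ s, N s) ≤ LinearMap.range (AddSubgroup.inclusion (integralHodgeClassesIn_le_integralForms Φ k p)).toIntLinearMap :=
  iSup_le fun s u hu ↦
    ⟨⟨(u : E [⋀^Fin k]→L[ℝ] ℂ), coe_mem_integralHodgeClassesIn_of_mem_lefschetzPiece hη hpk (hN s) hu⟩, Subtype.ext rfl⟩

omit [DecidableEq ι] in
/-- **`Hdgᵖ(X, ℤ)` has a `ℤ`-basis indexed like the assembled basis of `⊕_s N_s`** (`k = p + p ≤ g`): the integral Hodge lattice is free of rank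
`rk ⨆_s N_s = Σ_s rk N_s` (g47-#4), the cardinality of the index type `Σ s, κ s` of any family of bases `b_s` of the pieces.
[cite: Lange2023AbelianVarietiesComplex, §5.4.1 (5.22) (PDF p. 275); §7.3.2 (3); §7.2.2] -/
theorem IsPolarizationType.exists_basis_integralHodgeClassesIn_sigma (hd : IsPolarizationType Φ η d) (hη : IsRiemannForm Φ η)
    (hpk : p + p = k) (hk : k ≤ j + 2) (N : Fin (p + 1) → Submodule ℤ ↥(integralForms Φ k))
    (hN : ∀ (s : Fin (p + 1)) (u : ↥(integralForms Φ k)), u ∈ N s ↔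
      ∃ (m i : ℕ) (_ : i + i = m) (h : 2 * (s : ℕ) + m = k) (y : E [⋀^Fin m]→L[ℝ] ℂ),
        y ∈ integralHodgeClassesIn Φ m i ∧ y ∈ primitiveForms η m ∧ (u : E [⋀^Fin k]→L[ℝ] ℂ) = lefschetzPow η (s : ℕ) h y)
    {κ : Fin (p + 1) → Type*} [∀ s, Fintype (κ s)] (b : ∀ s, Basis (κ s) ℤ ↥(N s)) :
    Nonempty (Basis (Σ s, κ s) ℤ ↥(integralHodgeClassesIn Φ k p)) := by
  classical
  haveI := moduleFinite_integralHodgeClassesIn Φ k p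
  haveI := moduleFree_integralHodgeClassesIn Φ k p
  have hrk : finrank ℤ ↥(integralHodgeClassesIn Φ k p) = Fintype.card (Σ s, κ s) := by
    rw [← hd.finrank_iSup_lefschetzPieces_eq hη hpk hk N hN, hd.finrank_iSup_lefschetzPieces_eq_sum hη hpk hk N hN,
      Fintype.card_sigma]
    exact Finset.sum_congr rfl fun s _ ↦ finrank_eq_card_basis (b s)
  exact ⟨(finBasisOfFinrankEq ℤ _ hrk).reindex (Fintype.equivOfCardEq (by rw [Fintype.card_fin]))⟩

/-- **`∏_s disc(Lˢ Hdg^{p−s}(X, ℤ)_prim) = [Hdgᵖ(X, ℤ) : ⊕_s N_s]² · disc Hdgᵖ(X, ℤ)`** (`k = p + p`, `k + q = g`): Huybrechts' (0.1)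
`disc Λ₁ = (Λ : Λ₁)² · disc Λ` for the full-rank sublattice `Λ₁ = ⊕_s N_s` of `Λ = Hdgᵖ(X, ℤ)` (pulled back along the inclusion
`ι : Hdgᵖ(X, ℤ) ↪ Hᵏ(X, ℤ)`, with the form `B_k ∘ (ι × ι)`), combined with §2's `disc(⊕_s N_s) = ∏_s disc(N_s)`; `b_Λ` is any `ℤ`-basis of
`Hdgᵖ(X, ℤ)` indexed like the assembled basis. [cite: Huybrechts2016K3, Ch. 14 §0.1 (0.1), (0.2)] [cite: Kitaoka1993, Ch. 5 §5.3 Prop. 5.3.3 (proof)]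
[cite: Lange2023AbelianVarietiesComplex, §5.4.1 (5.22)–(5.23) (PDF p. 275); §7.3.2 (3)] [cite: VoisinHodgeI2002, §6.3.2 Thm. 6.32 (PDF p. 128)] -/
theorem IsPolarizationType.prod_det_lefschetzPieces_eq_index_sq_mul_det (hd : IsPolarizationType Φ η d) (hη : IsRiemannForm Φ η)
    (hkq : k + q = j + 2) (hq : q ≤ j + 2) {γ : E [⋀^Fin (2 * q)]→L[ℝ] ℂ}
    (hγ : wedgePow (ofRealForm η) q = ((q.factorial * ∏ i : Fin q, d (Fin.castLE hq i) : ℕ) : ℂ) • γ)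
    (e : Fin n ≃ ι) (hn : k + (2 * q + k) = n) {B : BilinForm ℤ ↥(integralForms Φ k)}
    (hB : ∀ x y : ↥(integralForms Φ k),
      ((B x y : ℤ) : ℂ) = poincarePairing Φ e hn (x : E [⋀^Fin k]→L[ℝ] ℂ) (γ.wedge (y : E [⋀^Fin k]→L[ℝ] ℂ)))
    (hpk : p + p = k) (N : Fin (p + 1) → Submodule ℤ ↥(integralForms Φ k))
    (hN : ∀ (s : Fin (p + 1)) (u : ↥(integralForms Φ k)), u ∈ N s ↔
      ∃ (m i : ℕ) (_ : i + i = m) (h : 2 * (s : ℕ) + m = k) (y : E [⋀^Fin m]→L[ℝ] ℂ),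
        y ∈ integralHodgeClassesIn Φ m i ∧ y ∈ primitiveForms η m ∧ (u : E [⋀^Fin k]→L[ℝ] ℂ) = lefschetzPow η (s : ℕ) h y)
    {κ : Fin (p + 1) → Type*} [∀ s, Fintype (κ s)] [∀ s, DecidableEq (κ s)] (b : ∀ s, Basis (κ s) ℤ ↥(N s))
    (bΛ : Basis (Σ s, κ s) ℤ ↥(integralHodgeClassesIn Φ k p)) :
    ∏ s, (LinearMap.BilinForm.toMatrix (b s) (B.restrict (N s))).det =
      ((((⨆ s, N s).comap (AddSubgroup.inclusion (integralHodgeClassesIn_le_integralForms Φ k p)).toIntLinearMap).toAddSubgroup.index : ℕ) : ℤ) ^ 2 *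
        (LinearMap.BilinForm.toMatrix bΛ (B.comp (AddSubgroup.inclusion (integralHodgeClassesIn_le_integralForms Φ k p)).toIntLinearMap
          (AddSubgroup.inclusion (integralHodgeClassesIn_le_integralForms Φ k p)).toIntLinearMap)).det := by
  obtain ⟨c, hc, hdet, -⟩ := hd.exists_basis_iSup_lefschetzPieces_det_eq_prod hη hkq hq hγ e hn hB N hN b
  have hinj : Injective (AddSubgroup.inclusion (integralHodgeClassesIn_le_integralForms Φ k p)).toIntLinearMap :=
    AddSubgroup.inclusion_injective (integralHodgeClassesIn_le_integralForms Φ k p)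
  have hle := iSup_lefschetzPieces_le_range_inclusion hη hpk N hN
  -- transport the assembled basis to the pulled-back sublattice of `Λ = Hdgᵖ(X, ℤ)`
  let e' : ↥((⨆ s, N s).comap (AddSubgroup.inclusion (integralHodgeClassesIn_le_integralForms Φ k p)).toIntLinearMap) ≃ₗ[ℤ] ↥(⨆ s, N s) :=
    (Submodule.equivMapOfInjective _ hinj _).trans (LinearEquiv.ofEq _ _ (Submodule.map_comap_eq_self hle))
  have he' : ∀ w, ((e' w : ↥(⨆ s, N s)) : ↥(integralForms Φ k)) =
      (AddSubgroup.inclusion (integralHodgeClassesIn_le_integralForms Φ k p)).toIntLinearMap w := fun _ ↦ rfl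
  have hι : ∀ z : ↥(⨆ s, N s), (AddSubgroup.inclusion (integralHodgeClassesIn_le_integralForms Φ k p)).toIntLinearMap
      ((e'.symm z : ↥((⨆ s, N s).comap (AddSubgroup.inclusion (integralHodgeClassesIn_le_integralForms Φ k p)).toIntLinearMap)) :
        ↥(integralHodgeClassesIn Φ k p)) = (z : ↥(integralForms Φ k)) := fun z ↦ by
    rw [← he', e'.apply_symm_apply]
  have h01 := LinearMap.BilinForm.det_toMatrix_restrict_eq_index_sq_mul
    (B.comp (AddSubgroup.inclusion (integralHodgeClassesIn_le_integralForms Φ k p)).toIntLinearMap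
      (AddSubgroup.inclusion (integralHodgeClassesIn_le_integralForms Φ k p)).toIntLinearMap)
    ((⨆ s, N s).comap (AddSubgroup.inclusion (integralHodgeClassesIn_le_integralForms Φ k p)).toIntLinearMap) bΛ (c.map e'.symm)
  rw [← hdet, ← h01]
  refine congrArg Matrix.det (Matrix.ext fun x y ↦ ?_)
  simp only [LinearMap.BilinForm.toMatrix_apply, LinearMap.BilinForm.restrict_apply, LinearMap.domRestrict_apply,
    LinearMap.BilinForm.comp_apply, Basis.map_apply]
  rw [hι, hι]

/-- **`disc Hdgᵖ(X, ℤ) ∣ ∏_s disc(Lˢ Hdg^{p−s}(X, ℤ)_prim)`, both non-zero, with quotient `[Hdgᵖ(X, ℤ) : ⊕_s N_s]²`** — the discriminant of the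
integral Hodge lattice is recovered from the primitive Hodge lattices of codimension `≤ p` (through their Lefschetz images) and the index of the
integral Lefschetz decomposition. [cite: Huybrechts2016K3, Ch. 14 §0.1 (0.1)] [cite: Kitaoka1993, Ch. 5 §5.3 Prop. 5.3.3 (proof)]
[cite: Lange2023AbelianVarietiesComplex, §5.4.1 (5.22)–(5.23) (PDF p. 275)] -/
theorem IsPolarizationType.det_integralHodgeClassesIn_dvd_prod_det_lefschetzPieces (hd : IsPolarizationType Φ η d) (hη : IsRiemannForm Φ η)
    (hkq : k + q = j + 2) (hq : q ≤ j + 2) {γ : E [⋀^Fin (2 * q)]→L[ℝ] ℂ}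
    (hγ : wedgePow (ofRealForm η) q = ((q.factorial * ∏ i : Fin q, d (Fin.castLE hq i) : ℕ) : ℂ) • γ)
    (e : Fin n ≃ ι) (hn : k + (2 * q + k) = n) {B : BilinForm ℤ ↥(integralForms Φ k)}
    (hB : ∀ x y : ↥(integralForms Φ k),
      ((B x y : ℤ) : ℂ) = poincarePairing Φ e hn (x : E [⋀^Fin k]→L[ℝ] ℂ) (γ.wedge (y : E [⋀^Fin k]→L[ℝ] ℂ)))
    (hpk : p + p = k) (N : Fin (p + 1) → Submodule ℤ ↥(integralForms Φ k))
    (hN : ∀ (s : Fin (p + 1)) (u : ↥(integralForms Φ k)), u ∈ N s ↔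
      ∃ (m i : ℕ) (_ : i + i = m) (h : 2 * (s : ℕ) + m = k) (y : E [⋀^Fin m]→L[ℝ] ℂ),
        y ∈ integralHodgeClassesIn Φ m i ∧ y ∈ primitiveForms η m ∧ (u : E [⋀^Fin k]→L[ℝ] ℂ) = lefschetzPow η (s : ℕ) h y)
    {κ : Fin (p + 1) → Type*} [∀ s, Fintype (κ s)] [∀ s, DecidableEq (κ s)] (b : ∀ s, Basis (κ s) ℤ ↥(N s))
    (bΛ : Basis (Σ s, κ s) ℤ ↥(integralHodgeClassesIn Φ k p)) :
    (LinearMap.BilinForm.toMatrix bΛ (B.comp (AddSubgroup.inclusion (integralHodgeClassesIn_le_integralForms Φ k p)).toIntLinearMap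
        (AddSubgroup.inclusion (integralHodgeClassesIn_le_integralForms Φ k p)).toIntLinearMap)).det ∣
      ∏ s, (LinearMap.BilinForm.toMatrix (b s) (B.restrict (N s))).det ∧
    ∏ s, (LinearMap.BilinForm.toMatrix (b s) (B.restrict (N s))).det ≠ 0 ∧
    (LinearMap.BilinForm.toMatrix bΛ (B.comp (AddSubgroup.inclusion (integralHodgeClassesIn_le_integralForms Φ k p)).toIntLinearMap
        (AddSubgroup.inclusion (integralHodgeClassesIn_le_integralForms Φ k p)).toIntLinearMap)).det ≠ 0 := by
  have h := hd.prod_det_lefschetzPieces_eq_index_sq_mul_det hη hkq hq hγ e hn hB hpk N hN b bΛ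
  obtain ⟨-, -, -, hne⟩ := hd.exists_basis_iSup_lefschetzPieces_det_eq_prod hη hkq hq hγ e hn hB N hN b
  have hprod : ∏ s, (LinearMap.BilinForm.toMatrix (b s) (B.restrict (N s))).det ≠ 0 := Finset.prod_ne_zero_iff.2 fun s _ ↦ hne s
  refine ⟨⟨_, h.trans (mul_comm _ _)⟩, hprod, fun h0 ↦ hprod ?_⟩
  rw [h, h0, mul_zero]

end Pieces

end Literature.Geometry.Kaehler.ComplexTorus

end
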